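import Literature.AlgebraicGeometry.RealAlgebraic.VeroneseCoordinates
import Literature.AlgebraicGeometry.Motives.KunnethSections
import HarnessLib

/-!
# Algebraic coordinates on the points of a product `X ×_k Y`

Let `k` be a field, `L ⊇ k` a field, and let `f₁, …, f_N ∈ Γ(X, V)`, `f'₁, …, f'_{N'} ∈ Γ(Y, V')`
be algebraic coordinate systems on the `L`-points of two `k`-schemes `X`, `Y`
(`Literature.AlgebraicGeometry.RealAlgebraic.IsAlgCoordSystem`, file
`RealAlgebraic/RealAlgebraicCoordinates`). This file proves that the `N + N'` functions
`pr_X^* f_j, pr_Y^* f'_j ∈ Γ(X ×_k Y, V ×_k V')` (`prodCoords`) form an algebraic coordinate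
system on the `L`-points of `X ×_k Y` (`IsAlgCoordSystem.prod`), whose coordinate map is
`P ↦ (f(pr_X P), f'(pr_Y P))` (`coordMap_prodCoords`, in the convention `Fin.append` of
`Literature.NumberTheory.Transcendental.IsSemialgebraicMapOn`).

The charts are the products `W ×_k W'` of charts (affine: the tree's
`isAffineOpen_productFamily`), with denominator `b(y) b'(y')`; the generation property
`Γ(X ×_k Y, W ×_k W') = k[coordinates][1/(b b')]`-generated follows from the **Künneth formula in
degree `0`**, `Γ(X, W) ⊗_k Γ(Y, W') ↠ Γ(X ×_k Y, W ×_k W')` (Görtz–Wedhorn II, Cor. 22.110 for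
`i = 0`; the tree's `kunnethSections_bijective_of_isAffineOpen`), applied to pure tensors
`a(f)/b(f)^m ⊗ a'(f')/b'(f')^{m'}`. This is the product step in the construction of the real
Abel–Jacobi package (`RealAbelJacobi.exists_realization`): it realises `(J × J)(ℝ)` inside
`ℝ^{N+N}` as `J(ℝ) × J(ℝ)` so that the group law `J × J → J` becomes a map of the ambient spaces.
No named fact is introduced.

## References

* U. Görtz, T. Wedhorn, *Algebraic Geometry II* (2023), Cor. 22.110 (p. 399). [GortzWedhorn2023]
* J. Bochnak, M. Coste, M.-F. Roy, *Real Algebraic Geometry* (1998), §2.1 (products of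
  semialgebraic sets), Prop. 2.2.6. [BochnakCosteRoy1998]
* S. Akbulut, H. King, *Topology of Real Algebraic Sets* (1992), Ch. II §4, Prop. 2.4.1.
  [AkbulutKing1992]
-/

universe u

noncomputable section

open CategoryTheory AlgebraicGeometry TopologicalSpace Opposite MonoidalCategory
open CartesianMonoidalCategory (fst snd)
open MvPolynomial (C aeval eval₂ rename)
open _root_.Topology

namespace Literature.AlgebraicGeometry.RealAlgebraic

open Literature.AlgebraicGeometry.Motives Literature.AlgebraicGeometry.Motives.GeneratingSections
  Literature.AlgebraicGeometry.Morphisms Literature.NumberTheory.Transcendental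
open scoped TensorProduct

variable {k : Type u} [Field k] {X Y : SchemeOver k} {N N' : ℕ}

/-! ### The product coordinates -/

section Defs

variable {V : X.left.Opens} {V' : Y.left.Opens}

/-- **Product coordinates**: the `N + N'` regular functions `pr_X^* f₁, …, pr_X^* f_N,
pr_Y^* f'₁, …, pr_Y^* f'_{N'}` on `V ×_k V' = pr_X⁻¹V ∩ pr_Y⁻¹V' ⊆ X ×_k Y` (appended).
[cite: BochnakCosteRoy1998, §2.1 (products)] -/
def prodCoords (f : Fin N → Γ(X.left, V)) (f' : Fin N' → Γ(Y.left, V')) :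
    Fin (N + N') → Γ((X ⊗ Y).left, prodOpen X Y V V') :=
  Fin.append (fun j => (fst X Y).left.appLE V (prodOpen X Y V V') inf_le_left (f j))
    (fun j => (snd X Y).left.appLE V' (prodOpen X Y V V') inf_le_right (f' j))

variable (f : Fin N → Γ(X.left, V)) (f' : Fin N' → Γ(Y.left, V'))

/-- The first `N` product coordinates are the `pr_X^* f_j`. [folklore] -/
@[simp] theorem prodCoords_castAdd (j : Fin N) :
    prodCoords f f' (Fin.castAdd N' j) =
      (fst X Y).left.appLE V (prodOpen X Y V V') inf_le_left (f j) := by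
  simp [prodCoords]

/-- The last `N'` product coordinates are the `pr_Y^* f'_j`. [folklore] -/
@[simp] theorem prodCoords_natAdd (j : Fin N') :
    prodCoords f f' (Fin.natAdd N j) =
      (snd X Y).left.appLE V' (prodOpen X Y V V') inf_le_right (f' j) := by
  simp [prodCoords]

end Defs

/-! ### Points of `X ×_k Y` and values of the product coordinates -/

section Points

variable {L : Type u} [Field L] [Algebra k L] {V : X.left.Opens} {V' : Y.left.Opens}
  (f : Fin N → Γ(X.left, V)) (f' : Fin N' → Γ(Y.left, V'))

/-- An `L`-point of `X ×_k Y` lies in `V ×_k V'` iff its projections lie in `V` and `V'`.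
[folklore] -/
theorem pt_mem_prodOpen_iff (P : AlgPoints (X ⊗ Y) L) :
    P.pt ∈ prodOpen X Y V V' ↔
      (AlgPoints.map (fst X Y) P).pt ∈ V ∧ (AlgPoints.map (snd X Y) P).pt ∈ V' :=
  Iff.rfl

/-- **Values of pulled-back functions**: `(pr_X^* s)(P) = s(pr_X P)` for `s ∈ Γ(X, V)` and
`P ∈ (U)(L)`, `U ⊆ pr_X⁻¹V` (`AlgPoints.eval_map` and restriction). [folklore] -/
theorem eval_appLE_eq {Z : SchemeOver k} (φ : Z ⟶ X) {U : Z.left.Opens} (hle : U ≤ φ.left ⁻¹ᵁ V)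
    (P : AlgPoints Z L) (hP : P.pt ∈ U) (s : Γ(X.left, V)) :
    P.eval U hP (φ.left.appLE V U hle s) = (AlgPoints.map φ P).eval V (hle hP) s := by
  rw [AlgPoints.eval_map]
  exact AlgPoints.eval_map_homOfLE hle _ hP

/-- **The coordinate map of the product coordinates is the pair of coordinate maps**:
`(pr_X^* f, pr_Y^* f')(P) = (f(pr_X P), f'(pr_Y P))` (appended), at every `L`-point whose
projections lie in `V` and `V'`. [folklore] -/
theorem coordMap_prodCoords (P : AlgPoints (X ⊗ Y) L) (h : (AlgPoints.map (fst X Y) P).pt ∈ V)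
    (h' : (AlgPoints.map (snd X Y) P).pt ∈ V') :
    coordMap L (prodOpen X Y V V') (prodCoords f f') P =
      Fin.append (coordMap L V f (AlgPoints.map (fst X Y) P))
        (coordMap L V' f' (AlgPoints.map (snd X Y) P)) := by
  have hP : P.pt ∈ prodOpen X Y V V' := (pt_mem_prodOpen_iff P).mpr ⟨h, h'⟩
  funext m
  refine Fin.addCases (fun j => ?_) (fun j => ?_) m
  · rw [Fin.append_left, coordMap_apply_of_mem hP, coordMap_apply_of_mem h, prodCoords_castAdd]
    exact eval_appLE_eq (fst X Y) inf_le_left P hP (f j)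
  · rw [Fin.append_right, coordMap_apply_of_mem hP, coordMap_apply_of_mem h', prodCoords_natAdd]
    exact eval_appLE_eq (snd X Y) inf_le_right P hP (f' j)

end Points

/-! ### The product of two algebraic coordinate systems -/

section Product

variable {V : X.left.Opens} {V' : Y.left.Opens} {f : Fin N → Γ(X.left, V)}
  {f' : Fin N' → Γ(Y.left, V')}

/-- **Pull-back of a substituted polynomial along `pr_X`**: for `W ⊆ V`, `W' ⊆ V'`,
`pr_X^*(a(f|_W)) = (a ∘ castAdd)(pr_X^*f, pr_Y^*f')|_{W ×_k W'}` in `Γ(X ×_k Y, W ×_k W')`.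
[folklore] -/
theorem appLE_fst_pullbackPoly {W : X.left.Opens} {W' : Y.left.Opens} (hWV : W ≤ V)
    (hW'V' : W' ≤ V') (a : MvPolynomial (Fin N) k) :
    (fst X Y).left.appLE W (prodOpen X Y W W') inf_le_left (pullbackPoly hWV f a) =
      pullbackPoly (prodOpen_mono X Y hWV hW'V') (prodCoords f f')
        (rename (Fin.castAdd N') a) := by
  rw [appLE_pullbackPoly, pullbackPoly, MvPolynomial.eval₂_rename]
  congr 1
  funext j
  simp only [Function.comp_apply, prodCoords_castAdd]
  change _ = ((fst X Y).left.appLE V (prodOpen X Y V V') inf_le_left ≫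
    (X ⊗ Y).left.presheaf.map (homOfLE (prodOpen_mono X Y hWV hW'V')).op) (f j)
  rw [Scheme.Hom.appLE_map]

/-- **Pull-back of a substituted polynomial along `pr_Y`**:
`pr_Y^*(a'(f'|_{W'})) = (a' ∘ natAdd)(pr_X^*f, pr_Y^*f')|_{W ×_k W'}`. [folklore] -/
theorem appLE_snd_pullbackPoly {W : X.left.Opens} {W' : Y.left.Opens} (hWV : W ≤ V)
    (hW'V' : W' ≤ V') (a' : MvPolynomial (Fin N') k) :
    (snd X Y).left.appLE W' (prodOpen X Y W W') inf_le_right (pullbackPoly hW'V' f' a') =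
      pullbackPoly (prodOpen_mono X Y hWV hW'V') (prodCoords f f')
        (rename (Fin.natAdd N) a') := by
  rw [appLE_pullbackPoly, pullbackPoly, MvPolynomial.eval₂_rename]
  congr 1
  funext j
  simp only [Function.comp_apply, prodCoords_natAdd]
  change _ = ((snd X Y).left.appLE V' (prodOpen X Y V V') inf_le_right ≫
    (X ⊗ Y).left.presheaf.map (homOfLE (prodOpen_mono X Y hWV hW'V')).op) (f' j)
  rw [Scheme.Hom.appLE_map]

variable {L : Type u} [Field L] [Algebra k L]

/-- Evaluating `a ∘ castAdd` at appended coordinates evaluates `a` at the first block.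
[folklore] -/
theorem aeval_append_rename_castAdd (y : Fin N → L) (y' : Fin N' → L)
    (a : MvPolynomial (Fin N) k) :
    aeval (Fin.append y y') (rename (Fin.castAdd N') a) = aeval y a := by
  rw [MvPolynomial.aeval_rename]
  have h : (Fin.append y y' ∘ Fin.castAdd N') = y := funext fun j => by simp
  rw [h]

/-- Evaluating `a' ∘ natAdd` at appended coordinates evaluates `a'` at the second block.
[folklore] -/
theorem aeval_append_rename_natAdd (y : Fin N → L) (y' : Fin N' → L)
    (a' : MvPolynomial (Fin N') k) :
    aeval (Fin.append y y') (rename (Fin.natAdd N) a') = aeval y' a' := by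
  rw [MvPolynomial.aeval_rename]
  have h : (Fin.append y y' ∘ Fin.natAdd N) = y' := funext fun j => by simp
  rw [h]

/-- **The product of two algebraic coordinate systems is an algebraic coordinate system** on the
`L`-points of `X ×_k Y`: coordinates `(pr_X^* f, pr_Y^* f')` on `V ×_k V'`; charts the products
`W ×_k W'` of charts (affine opens), with denominator `b(y) · b'(y')`; generation by the Künneth
formula in degree `0`, `Γ(X, W) ⊗_k Γ(Y, W') ↠ Γ(X ×_k Y, W ×_k W')` (Görtz–Wedhorn II,
Cor. 22.110, `i = 0`). [cite: GortzWedhorn2023, Cor. 22.110 (p. 399), i = 0] -/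
theorem IsAlgCoordSystem.prod (hc : IsAlgCoordSystem L V f) (hc' : IsAlgCoordSystem L V' f') :
    IsAlgCoordSystem L (prodOpen X Y V V') (prodCoords f f') := by
  classical
  refine ⟨fun P => (pt_mem_prodOpen_iff P).mpr ⟨hc.pt_mem _, hc'.pt_mem _⟩, fun P => ?_⟩
  obtain ⟨W, hWV, b, hWa, hPW, hWb, hbu, hgen⟩ := hc.exists_chart (AlgPoints.map (fst X Y) P)
  obtain ⟨W', hW'V', b', hW'a, hPW', hW'b', hb'u, hgen'⟩ :=
    hc'.exists_chart (AlgPoints.map (snd X Y) P)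
  -- the chart `W ×_k W'`, denominator `b b'`
  have hO : prodOpen X Y W W' ≤ prodOpen X Y V V' := prodOpen_mono X Y hWV hW'V'
  set B : MvPolynomial (Fin (N + N')) k :=
    rename (Fin.castAdd N') b * rename (Fin.natAdd N) b' with hB
  clear_value B
  have hBX : pullbackPoly hO (prodCoords f f') (rename (Fin.castAdd N') b) =
      (fst X Y).left.appLE W (prodOpen X Y W W') inf_le_left (pullbackPoly hWV f b) :=
    (appLE_fst_pullbackPoly hWV hW'V' b).symm
  have hBY : pullbackPoly hO (prodCoords f f') (rename (Fin.natAdd N) b') =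
      (snd X Y).left.appLE W' (prodOpen X Y W W') inf_le_right (pullbackPoly hW'V' f' b') :=
    (appLE_snd_pullbackPoly hWV hW'V' b').symm
  refine ⟨prodOpen X Y W W', hO, B, ?_, (pt_mem_prodOpen_iff P).mpr ⟨hPW, hPW'⟩, fun Q => ?_, ?_,
    fun s => ?_⟩
  · -- affine
    exact isAffineOpen_productFamily X Y (V := fun _ : Unit => W) (W := fun _ : Unit => W')
      (a := ()) (b := ()) hWa hW'a
  · -- membership
    rw [pt_mem_prodOpen_iff, hWb, hW'b',
      coordMap_prodCoords f f' Q (hc.pt_mem _) (hc'.pt_mem _), hB, map_mul,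
      aeval_append_rename_castAdd, aeval_append_rename_natAdd, mul_ne_zero_iff]
  · -- unit
    rw [hB, pullbackPoly_mul, hBX, hBY]
    exact (hbu.map ((fst X Y).left.appLE W (prodOpen X Y W W') inf_le_left).hom).mul
      (hb'u.map ((snd X Y).left.appLE W' (prodOpen X Y W W') inf_le_right).hom)
  · -- generation, by Künneth in degree 0
    set Pp : MvPolynomial (Fin (N + N')) k → Γ((X ⊗ Y).left, prodOpen X Y W W') :=
      fun a => pullbackPoly hO (prodCoords f f') a with hPp
    set θ : Sections X.hom W ⊗[k] Sections Y.hom W' → Γ((X ⊗ Y).left, prodOpen X Y W W') :=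
      fun t => kunnethSections X Y W W' t with hθ
    have hθ_tmul : ∀ (x : Sections X.hom W) (y : Sections Y.hom W'), θ (x ⊗ₜ y) =
        (fst X Y).left.appLE W (prodOpen X Y W W') inf_le_left x *
          (snd X Y).left.appLE W' (prodOpen X Y W W') inf_le_right y :=
      fun x y => kunnethSections_tmul X Y W W' x y
    have hθ_add : ∀ t₁ t₂, θ (t₁ + t₂) = θ t₁ + θ t₂ := fun t₁ t₂ => map_add _ t₁ t₂
    have hθ_zero : θ 0 = 0 := map_zero _
    -- the claim for every tensor
    have key : ∀ t, ∃ (a : MvPolynomial (Fin (N + N')) k) (M : ℕ), θ t * Pp B ^ M = Pp a := by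
      intro t
      induction t using TensorProduct.induction_on with
      | zero =>
        exact ⟨0, 0, by simp only [hθ_zero, zero_mul, hPp, pullbackPoly, MvPolynomial.eval₂_zero]⟩
      | tmul x y =>
        obtain ⟨a, m, ha⟩ := hgen x
        obtain ⟨a', m', ha'⟩ := hgen' y
        refine ⟨rename (Fin.castAdd N') (a * b ^ m') * rename (Fin.natAdd N) (a' * b' ^ m),
          m + m', ?_⟩
        have e1 : pullbackPoly hWV f (a * b ^ m') =
            pullbackPoly hWV f a * pullbackPoly hWV f b ^ m' := by
          rw [pullbackPoly_mul, pullbackPoly_pow]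
        have e2 : pullbackPoly hW'V' f' (a' * b' ^ m) =
            pullbackPoly hW'V' f' a' * pullbackPoly hW'V' f' b' ^ m := by
          rw [pullbackPoly_mul, pullbackPoly_pow]
        simp only [hPp]
        rw [hθ_tmul, hB, pullbackPoly_mul, hBX, hBY, pullbackPoly_mul,
          ← appLE_fst_pullbackPoly hWV hW'V' (a * b ^ m'),
          ← appLE_snd_pullbackPoly hWV hW'V' (a' * b' ^ m), e1, e2, ← ha, ← ha']
        simp only [map_mul, map_pow]
        ring
      | add t₁ t₂ h₁ h₂ =>
        obtain ⟨a₁, M₁, h₁⟩ := h₁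
        obtain ⟨a₂, M₂, h₂⟩ := h₂
        refine ⟨a₁ * B ^ M₂ + a₂ * B ^ M₁, M₁ + M₂, ?_⟩
        simp only [hPp] at h₁ h₂ ⊢
        rw [hθ_add, add_mul, pullbackPoly_add, pullbackPoly_mul, pullbackPoly_mul,
          pullbackPoly_pow, pullbackPoly_pow, ← h₁, ← h₂, pow_add]
        ring
    -- conclude by surjectivity of the Künneth map
    obtain ⟨t, ht⟩ := (kunnethSections_bijective_of_isAffineOpen X Y hWa hW'a).2 s
    obtain ⟨a, M, hM⟩ := key t
    refine ⟨a, M, ?_⟩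
    have hts : θ t = s := ht
    rw [← hts]
    exact hM

end Product

end Literature.AlgebraicGeometry.RealAlgebraic

end
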